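import Summits.QuantumAdvantage.QuantumAdvantage.Theorems.CharDialJLinGroupCore
import Summits.QuantumAdvantage.QuantumAdvantage.Theorems.CharDialJLinVPECore
import HarnessLib

/-!
# Cell qa-qnc0 / decomp-qadv (odd primes): the group-core residual CARVED (R6/R8) and SPLIT BY READ DENSITY; item 32604 BY NAME

TREE-READY PART 10 of the node `HOME/decomp-qadv-lens-6/g10/CodeDial.lean` (§23, §24, §26), on top of part 9 (item 32604 at `p`
⟺ group-core hardness) and part 6 (`CharDialJLinVPECore`: `shots`, `strat_hasDegF`, `vpe_of_manyReaders`).  ZERO hardness `def`s.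

* `groupCore_iff_vpeGroup` (`p ≥ 5`): group-core hardness ⟺ hardness on group-cores that are `√n`-dense in shots and have every
  adjacent pair far-read (R6 `walkHardFShotsSqrt`, R8 `walkHardFFewReaders` BY NAME on the complement); `vpeGroup_of_manyReaders`:
  OddPrimeWalk's 23109 ⟹ it;
* **`groupCore_iff_readSplit`**: group-core hardness ⟺ (A) DENSE-READ hardness (for every constant `K ≥ 1`: no SPARSE bit: every read non-junta
  bit has `> n/K` readers; such data ARE group-cores, `groupCore_of_denseRead`) ∧ (B) SPARSE group-core hardness (for some constant
  `K ≥ 1`: group-cores possessing a read non-junta bit with `≤ n/K` readers) — a case split on a decidable predicate singled out by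
  part 7's rate wall `codeCost_ge`;
* BY NAME: **`charDial_walkHardFJLinOdd_iff_groupCore`**, `charDial_walkHardFJLinOdd_iff_readSplit`, `charDial_frobHardOdd_of_groupCore`,
  `charDial_closes_of_groupCore`, `charDial_closes_of_readSplit` (CharDial's item 32604 / crux 32598 / leaf from the pieces).

LANDING HYGIENE (as part 6): the corollary `ManyReadersSqrtOdd → CharDial.WalkHardFJLinOdd` is NOT declared (its hypothesis is the
registered item 23109; the node file carries it).
-/

noncomputable section

namespace Summit.QuantumAdvantage.AdviceFreeQNC0.JLinPeel

open Finset Summit.QuantumAdvantage.AdviceFreeQNC0 TwistedTransfer JLinData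

/-! ### Carving by the proved ceilings R6 / R8 -/

/-- VPE-group-core hardness implies group-core hardness (`p ≥ 5`; R6 / R8 BY NAME on the complement). -/
theorem groupCore_of_vpeGroup (p : ℕ) [Fact p.Prime] (hp : 5 ≤ p)
    (hV : ∀ C' : ℕ, ∃ θ : ℝ, θ < 1 ∧ ∃ n₀ : ℕ, ∀ n ≥ n₀, ∀ (c : ℕ) (D : JLinData p n),
      (∀ g, (D.J g).card ≤ Nat.log 2 n) → D.lightGroups (C' * Nat.log 2 n) = ∅ →
        ¬ (D.shots ^ 2 * (Nat.log 2 n) ^ 7 ≤ n) →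
        (∀ w a : ℕ, ∀ S : Finset (Fin (n + 1)), w ≤ (Nat.log 2 n) ^ 2 → a + 2 ≤ n → S.card ≤ (Nat.log 2 n) ^ 2 →
          ∃ g : Fin (n + 1), g ∉ S ∧ (g.val + w < a ∨ a + 2 + w < g.val) ∧
            ∃ u v : Fin n → Bool, (∀ i : Fin n, i.val ≠ a → i.val ≠ a + 1 → u i = v i) ∧ D.strat g u ≠ D.strat g v) →
        (winCount c D.strat : ℝ) ≤ θ * (2 : ℝ) ^ n) :
    ∀ C' : ℕ, ∃ θ : ℝ, θ < 1 ∧ ∃ n₀ : ℕ, ∀ n ≥ n₀, ∀ (c : ℕ) (D : JLinData p n),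
      (∀ g, (D.J g).card ≤ Nat.log 2 n) → D.lightGroups (C' * Nat.log 2 n) = ∅ → (winCount c D.strat : ℝ) ≤ θ * (2 : ℝ) ^ n := by
  intro C'
  obtain ⟨θ₁, hθ₁, hS⟩ := walkHardFShotsSqrt p (by omega)
  obtain ⟨n₁, hn₁⟩ := hS 2
  obtain ⟨θ₂, hθ₂, hF⟩ := walkHardFFewReaders p (by omega)
  obtain ⟨n₂, hn₂⟩ := hF 2
  obtain ⟨θ₃, hθ₃, n₃, hn₃⟩ := hV C'
  refine ⟨max θ₁ (max θ₂ θ₃), max_lt hθ₁ (max_lt hθ₂ hθ₃), max (max n₁ n₂) (max n₃ (2 ^ p)), fun n hn c D hJ hcore => ?_⟩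
  have hn₁' : n₁ ≤ n := le_trans (le_max_left _ _) (le_trans (le_max_left _ _) hn)
  have hn₂' : n₂ ≤ n := le_trans (le_max_right _ _) (le_trans (le_max_left _ _) hn)
  have hn₃' : n₃ ≤ n := le_trans (le_max_left _ _) (le_trans (le_max_right _ _) hn)
  have hnp : 2 ^ p ≤ n := le_trans (le_max_right _ _) (le_trans (le_max_right _ _) hn)
  have hdeg : ∀ g, HasDegF p (D.strat g) ((Nat.log 2 n) ^ 2) := fun g => D.strat_hasDegF hJ hnp g
  have h2n : (0 : ℝ) ≤ (2 : ℝ) ^ n := by positivity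
  have hθmax₁ : θ₁ * (2 : ℝ) ^ n ≤ max θ₁ (max θ₂ θ₃) * (2 : ℝ) ^ n :=
    mul_le_mul_of_nonneg_right (le_max_left _ _) h2n
  have hθmax₂ : θ₂ * (2 : ℝ) ^ n ≤ max θ₁ (max θ₂ θ₃) * (2 : ℝ) ^ n :=
    mul_le_mul_of_nonneg_right (le_trans (le_max_left _ _) (le_max_right _ _)) h2n
  have hθmax₃ : θ₃ * (2 : ℝ) ^ n ≤ max θ₁ (max θ₂ θ₃) * (2 : ℝ) ^ n :=
    mul_le_mul_of_nonneg_right (le_trans (le_max_right _ _) (le_max_right _ _)) h2n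
  by_cases hdense : D.shots ^ 2 * (Nat.log 2 n) ^ 7 ≤ n
  · have h := hn₁ n hn₁' c D.shots D.strat hdeg (fun u => D.shots_le u) (by simpa using hdense)
    exact le_trans (by exact_mod_cast h) hθmax₁
  · by_cases hfar : (∀ w a : ℕ, ∀ S : Finset (Fin (n + 1)), w ≤ (Nat.log 2 n) ^ 2 → a + 2 ≤ n → S.card ≤ (Nat.log 2 n) ^ 2 →
        ∃ g : Fin (n + 1), g ∉ S ∧ (g.val + w < a ∨ a + 2 + w < g.val) ∧
          ∃ u v : Fin n → Bool, (∀ i : Fin n, i.val ≠ a → i.val ≠ a + 1 → u i = v i) ∧ D.strat g u ≠ D.strat g v)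
    · exact (hn₃ n hn₃' c D hJ hcore hdense hfar).trans hθmax₃
    · push Not at hfar
      obtain ⟨w, a, S, hw, ha, hSc, hall⟩ := hfar
      have h := hn₂ n hn₂' c w a hw ha D.strat hdeg S hSc (fun g hg hgfar u v huv => hall g hg hgfar u v huv)
      exact le_trans (by exact_mod_cast h) hθmax₂

/-- The converse is trivial. -/
theorem vpeGroup_of_groupCore (p : ℕ) [Fact p.Prime]
    (hC : ∀ C' : ℕ, ∃ θ : ℝ, θ < 1 ∧ ∃ n₀ : ℕ, ∀ n ≥ n₀, ∀ (c : ℕ) (D : JLinData p n),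
      (∀ g, (D.J g).card ≤ Nat.log 2 n) → D.lightGroups (C' * Nat.log 2 n) = ∅ → (winCount c D.strat : ℝ) ≤ θ * (2 : ℝ) ^ n) :
    ∀ C' : ℕ, ∃ θ : ℝ, θ < 1 ∧ ∃ n₀ : ℕ, ∀ n ≥ n₀, ∀ (c : ℕ) (D : JLinData p n),
      (∀ g, (D.J g).card ≤ Nat.log 2 n) → D.lightGroups (C' * Nat.log 2 n) = ∅ →
        ¬ (D.shots ^ 2 * (Nat.log 2 n) ^ 7 ≤ n) →
        (∀ w a : ℕ, ∀ S : Finset (Fin (n + 1)), w ≤ (Nat.log 2 n) ^ 2 → a + 2 ≤ n → S.card ≤ (Nat.log 2 n) ^ 2 →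
          ∃ g : Fin (n + 1), g ∉ S ∧ (g.val + w < a ∨ a + 2 + w < g.val) ∧
            ∃ u v : Fin n → Bool, (∀ i : Fin n, i.val ≠ a → i.val ≠ a + 1 → u i = v i) ∧ D.strat g u ≠ D.strat g v) →
        (winCount c D.strat : ℝ) ≤ θ * (2 : ℝ) ^ n := fun C' => by
  obtain ⟨θ, hθ, n₀, hn₀⟩ := hC C'
  exact ⟨θ, hθ, n₀, fun n hn c D hJ hcore _ _ => hn₀ n hn c D hJ hcore⟩

/-- **Group-core hardness ⟺ VPE-group-core hardness** (`p ≥ 5`). -/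
theorem groupCore_iff_vpeGroup (p : ℕ) [Fact p.Prime] (hp : 5 ≤ p) :
    (∀ C' : ℕ, ∃ θ : ℝ, θ < 1 ∧ ∃ n₀ : ℕ, ∀ n ≥ n₀, ∀ (c : ℕ) (D : JLinData p n),
      (∀ g, (D.J g).card ≤ Nat.log 2 n) → D.lightGroups (C' * Nat.log 2 n) = ∅ → (winCount c D.strat : ℝ) ≤ θ * (2 : ℝ) ^ n) ↔
    (∀ C' : ℕ, ∃ θ : ℝ, θ < 1 ∧ ∃ n₀ : ℕ, ∀ n ≥ n₀, ∀ (c : ℕ) (D : JLinData p n),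
      (∀ g, (D.J g).card ≤ Nat.log 2 n) → D.lightGroups (C' * Nat.log 2 n) = ∅ →
        ¬ (D.shots ^ 2 * (Nat.log 2 n) ^ 7 ≤ n) →
        (∀ w a : ℕ, ∀ S : Finset (Fin (n + 1)), w ≤ (Nat.log 2 n) ^ 2 → a + 2 ≤ n → S.card ≤ (Nat.log 2 n) ^ 2 →
          ∃ g : Fin (n + 1), g ∉ S ∧ (g.val + w < a ∨ a + 2 + w < g.val) ∧
            ∃ u v : Fin n → Bool, (∀ i : Fin n, i.val ≠ a → i.val ≠ a + 1 → u i = v i) ∧ D.strat g u ≠ D.strat g v) →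
        (winCount c D.strat : ℝ) ≤ θ * (2 : ℝ) ^ n) :=
  ⟨vpeGroup_of_groupCore p, groupCore_of_vpeGroup p hp⟩

/-- **OddPrimeWalk's 23109 `ManyReadersSqrtOdd` ⟹ VPE-group-core hardness** (`p ≥ 5`; part 6 + `core_of_groupCore`). -/
theorem vpeGroup_of_manyReaders (hM : Summit.QuantumAdvantage.QuantumAdvantage.Theses.OddPrimeWalk.ManyReadersSqrtOdd) (p : ℕ) [Fact p.Prime] (hp : 5 ≤ p) :
    ∀ C' : ℕ, ∃ θ : ℝ, θ < 1 ∧ ∃ n₀ : ℕ, ∀ n ≥ n₀, ∀ (c : ℕ) (D : JLinData p n),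
      (∀ g, (D.J g).card ≤ Nat.log 2 n) → D.lightGroups (C' * Nat.log 2 n) = ∅ →
        ¬ (D.shots ^ 2 * (Nat.log 2 n) ^ 7 ≤ n) →
        (∀ w a : ℕ, ∀ S : Finset (Fin (n + 1)), w ≤ (Nat.log 2 n) ^ 2 → a + 2 ≤ n → S.card ≤ (Nat.log 2 n) ^ 2 →
          ∃ g : Fin (n + 1), g ∉ S ∧ (g.val + w < a ∨ a + 2 + w < g.val) ∧
            ∃ u v : Fin n → Bool, (∀ i : Fin n, i.val ≠ a → i.val ≠ a + 1 → u i = v i) ∧ D.strat g u ≠ D.strat g v) →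
        (winCount c D.strat : ℝ) ≤ θ * (2 : ℝ) ^ n := by
  intro C'
  obtain ⟨θ, hθ, n₀, hn₀⟩ := vpe_of_manyReaders hM p hp C'
  exact ⟨θ, hθ, n₀, fun n hn c D hJ hcore hd hf => hn₀ n hn c D hJ (core_of_groupCore D hcore) hd hf⟩

/-! ### The READ-DENSITY split of the residual: group-core hardness ⟺ A ∧ B -/

/-- W-edge A: group-core hardness implies DENSE-READ hardness (dense-read data are group-cores: `groupCore_of_denseRead` with
`L·R > n`, residual at `C' = K`). -/
theorem dense_of_groupCore (p : ℕ) [Fact p.Prime]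
    (h : ∀ C' : ℕ, ∃ θ : ℝ, θ < 1 ∧ ∃ n₀ : ℕ, ∀ n ≥ n₀, ∀ (c : ℕ) (D : JLinData p n),
      (∀ g, (D.J g).card ≤ Nat.log 2 n) → D.lightGroups (C' * Nat.log 2 n) = ∅ → (winCount c D.strat : ℝ) ≤ θ * (2 : ℝ) ^ n) :
    ∀ K : ℕ, 1 ≤ K → ∃ θ : ℝ, θ < 1 ∧ ∃ n₀ : ℕ, ∀ n ≥ n₀, ∀ (c : ℕ) (D : JLinData p n),
      (∀ g, (D.J g).card ≤ Nat.log 2 n) → D.sparseBits (n / K + 1) = ∅ → (winCount c D.strat : ℝ) ≤ θ * (2 : ℝ) ^ n := by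
  intro K hK
  obtain ⟨θ, hθ, n₀, hn₀⟩ := h K
  refine ⟨θ, hθ, max n₀ 2, fun n hn c D hJ hdense => hn₀ n (le_trans (le_max_left _ _) hn) c D hJ ?_⟩
  have hn2 : 2 ≤ n := le_trans (le_max_right _ _) hn
  have hlog : 1 ≤ Nat.log 2 n := Nat.le_log_of_pow_le one_lt_two (by simpa using hn2)
  refine groupCore_of_denseRead D hdense ?_
  have h1 : n < K * (n / K + 1) := by
    rw [Nat.mul_add, mul_one]
    have := Nat.lt_div_mul_add hK (a := n)
    rw [mul_comm] at this
    exact this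
  have h2 : K * (n / K + 1) ≤ K * Nat.log 2 n * (n / K + 1) := by
    have : K ≤ K * Nat.log 2 n := Nat.le_mul_of_pos_right K hlog
    exact Nat.mul_le_mul_right _ this
  omega

/-- W-edge B: group-core hardness implies SPARSE group-core hardness (`K = 1`). -/
theorem sparse_of_groupCore (p : ℕ) [Fact p.Prime]
    (h : ∀ C' : ℕ, ∃ θ : ℝ, θ < 1 ∧ ∃ n₀ : ℕ, ∀ n ≥ n₀, ∀ (c : ℕ) (D : JLinData p n),
      (∀ g, (D.J g).card ≤ Nat.log 2 n) → D.lightGroups (C' * Nat.log 2 n) = ∅ → (winCount c D.strat : ℝ) ≤ θ * (2 : ℝ) ^ n) :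
    ∃ K : ℕ, 1 ≤ K ∧ ∀ C' : ℕ, 1 ≤ C' → ∃ θ : ℝ, θ < 1 ∧ ∃ n₀ : ℕ, ∀ n ≥ n₀, ∀ (c : ℕ) (D : JLinData p n),
      (∀ g, (D.J g).card ≤ Nat.log 2 n) → D.lightGroups (C' * Nat.log 2 n) = ∅ →
        D.sparseBits (n / K + 1) ≠ ∅ → (winCount c D.strat : ℝ) ≤ θ * (2 : ℝ) ^ n :=
  ⟨1, le_rfl, fun C' _ => by
    obtain ⟨θ, hθ, n₀, hn₀⟩ := h C'
    exact ⟨θ, hθ, n₀, fun n hn c D hJ hcore _ => hn₀ n hn c D hJ hcore⟩⟩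

/-- **The split glues**: A → B → group-core hardness (case split on the decidable read-density predicate at B's constant `K`;
group-cores are monotone in `L`, so `C'` may be raised to `max C' 1`). -/
theorem groupCore_of_readSplit (p : ℕ) [Fact p.Prime]
    (hA : ∀ K : ℕ, 1 ≤ K → ∃ θ : ℝ, θ < 1 ∧ ∃ n₀ : ℕ, ∀ n ≥ n₀, ∀ (c : ℕ) (D : JLinData p n),
      (∀ g, (D.J g).card ≤ Nat.log 2 n) → D.sparseBits (n / K + 1) = ∅ → (winCount c D.strat : ℝ) ≤ θ * (2 : ℝ) ^ n)
    (hB : ∃ K : ℕ, 1 ≤ K ∧ ∀ C' : ℕ, 1 ≤ C' → ∃ θ : ℝ, θ < 1 ∧ ∃ n₀ : ℕ, ∀ n ≥ n₀, ∀ (c : ℕ) (D : JLinData p n),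
      (∀ g, (D.J g).card ≤ Nat.log 2 n) → D.lightGroups (C' * Nat.log 2 n) = ∅ →
        D.sparseBits (n / K + 1) ≠ ∅ → (winCount c D.strat : ℝ) ≤ θ * (2 : ℝ) ^ n) :
    ∀ C' : ℕ, ∃ θ : ℝ, θ < 1 ∧ ∃ n₀ : ℕ, ∀ n ≥ n₀, ∀ (c : ℕ) (D : JLinData p n),
      (∀ g, (D.J g).card ≤ Nat.log 2 n) → D.lightGroups (C' * Nat.log 2 n) = ∅ → (winCount c D.strat : ℝ) ≤ θ * (2 : ℝ) ^ n := by
  obtain ⟨K, hK, hBK⟩ := hB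
  intro C'
  have hC'' : 1 ≤ max C' 1 := le_max_right _ _
  obtain ⟨θA, hθA, nA, hnA⟩ := hA K hK
  obtain ⟨θB, hθB, nB, hnB⟩ := hBK (max C' 1) hC''
  refine ⟨max θA θB, max_lt hθA hθB, max nA nB, fun n hn c D hJ hcore => ?_⟩
  have hcore'' : D.lightGroups (max C' 1 * Nat.log 2 n) = ∅ :=
    groupCore_mono D hcore (Nat.mul_le_mul_right _ (le_max_left _ _))
  have h2n : (0 : ℝ) ≤ (2 : ℝ) ^ n := by positivity
  by_cases hd : D.sparseBits (n / K + 1) = ∅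
  · exact (hnA n (le_trans (le_max_left _ _) hn) c D hJ hd).trans (mul_le_mul_of_nonneg_right (le_max_left _ _) h2n)
  · exact (hnB n (le_trans (le_max_right _ _) hn) c D hJ hcore'' hd).trans (mul_le_mul_of_nonneg_right (le_max_right _ _) h2n)

/-- **Group-core hardness ⟺ A ∧ B** (PROVED). -/
theorem groupCore_iff_readSplit (p : ℕ) [Fact p.Prime] :
    (∀ C' : ℕ, ∃ θ : ℝ, θ < 1 ∧ ∃ n₀ : ℕ, ∀ n ≥ n₀, ∀ (c : ℕ) (D : JLinData p n),
      (∀ g, (D.J g).card ≤ Nat.log 2 n) → D.lightGroups (C' * Nat.log 2 n) = ∅ → (winCount c D.strat : ℝ) ≤ θ * (2 : ℝ) ^ n) ↔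
    ((∀ K : ℕ, 1 ≤ K → ∃ θ : ℝ, θ < 1 ∧ ∃ n₀ : ℕ, ∀ n ≥ n₀, ∀ (c : ℕ) (D : JLinData p n),
      (∀ g, (D.J g).card ≤ Nat.log 2 n) → D.sparseBits (n / K + 1) = ∅ → (winCount c D.strat : ℝ) ≤ θ * (2 : ℝ) ^ n) ∧
     (∃ K : ℕ, 1 ≤ K ∧ ∀ C' : ℕ, 1 ≤ C' → ∃ θ : ℝ, θ < 1 ∧ ∃ n₀ : ℕ, ∀ n ≥ n₀, ∀ (c : ℕ) (D : JLinData p n),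
      (∀ g, (D.J g).card ≤ Nat.log 2 n) → D.lightGroups (C' * Nat.log 2 n) = ∅ →
        D.sparseBits (n / K + 1) ≠ ∅ → (winCount c D.strat : ℝ) ≤ θ * (2 : ℝ) ^ n)) :=
  ⟨fun h => ⟨dense_of_groupCore p h, sparse_of_groupCore p h⟩, fun h => groupCore_of_readSplit p h.1 h.2⟩

/-- **Item 32604 at `p` ⟺ A ∧ B** (`p ≠ 3`). -/
theorem pres_iff_readSplit (p : ℕ) [Fact p.Prime] (hp3 : p ≠ 3) :
    (∃ θ : ℝ, θ < 1 ∧ ∃ n₀ : ℕ, ∀ n ≥ n₀, ∀ c : ℕ, ∀ y : Fin (n + 1) → (Fin n → Bool) → Bool,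
      (∀ g, ∃ J : Finset (Fin n), J.card ≤ Nat.log 2 n ∧ ∃ a : Fin n → ZMod p, ∃ h : (Fin n → Bool) → ZMod p → Bool,
          (∀ u v : Fin n → Bool, (∀ i ∈ J, u i = v i) → ∀ s, h u s = h v s) ∧
            ∀ u, y g u = h u (∑ i, if u i then a i else 0)) →
        ((Finset.univ.filter fun u : Fin n → Bool => ringWinU c y u = true).card : ℝ) ≤ θ * (2 : ℝ) ^ n) ↔
    ((∀ K : ℕ, 1 ≤ K → ∃ θ : ℝ, θ < 1 ∧ ∃ n₀ : ℕ, ∀ n ≥ n₀, ∀ (c : ℕ) (D : JLinData p n),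
      (∀ g, (D.J g).card ≤ Nat.log 2 n) → D.sparseBits (n / K + 1) = ∅ → (winCount c D.strat : ℝ) ≤ θ * (2 : ℝ) ^ n) ∧
     (∃ K : ℕ, 1 ≤ K ∧ ∀ C' : ℕ, 1 ≤ C' → ∃ θ : ℝ, θ < 1 ∧ ∃ n₀ : ℕ, ∀ n ≥ n₀, ∀ (c : ℕ) (D : JLinData p n),
      (∀ g, (D.J g).card ≤ Nat.log 2 n) → D.lightGroups (C' * Nat.log 2 n) = ∅ →
        D.sparseBits (n / K + 1) ≠ ∅ → (winCount c D.strat : ℝ) ≤ θ * (2 : ℝ) ^ n)) :=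
  (pres_iff_groupCore p hp3).trans (groupCore_iff_readSplit p)

/-! ### CharDial's item 32604, its crux `FrobHardOdd` and its leaf, from the pieces BY NAME -/

/-- **CharDial item 32604 ⟺ group-core hardness at every prime `p ≥ 5`.** -/
theorem charDial_walkHardFJLinOdd_iff_groupCore :
    Summit.QuantumAdvantage.QuantumAdvantage.Theses.CharDial.WalkHardFJLinOdd ↔ ∀ (p : ℕ) [Fact p.Prime], 5 ≤ p →
      ∀ C' : ℕ, ∃ θ : ℝ, θ < 1 ∧ ∃ n₀ : ℕ, ∀ n ≥ n₀, ∀ (c : ℕ) (D : JLinData p n),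
      (∀ g, (D.J g).card ≤ Nat.log 2 n) → D.lightGroups (C' * Nat.log 2 n) = ∅ → (winCount c D.strat : ℝ) ≤ θ * (2 : ℝ) ^ n :=
  ⟨fun h p _ hp => (pres_iff_groupCore p (by omega)).1 (h p hp), fun hC p _ hp => (pres_iff_groupCore p (by omega)).2 (hC p hp)⟩

/-- **CharDial item 32604 ⟸ group-core hardness** (`closes` shape). -/
theorem charDial_walkHardFJLinOdd_of_groupCore
    (hC : ∀ (p : ℕ) [Fact p.Prime], 5 ≤ p →
      ∀ C' : ℕ, ∃ θ : ℝ, θ < 1 ∧ ∃ n₀ : ℕ, ∀ n ≥ n₀, ∀ (c : ℕ) (D : JLinData p n),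
      (∀ g, (D.J g).card ≤ Nat.log 2 n) → D.lightGroups (C' * Nat.log 2 n) = ∅ → (winCount c D.strat : ℝ) ≤ θ * (2 : ℝ) ^ n) :
    Summit.QuantumAdvantage.QuantumAdvantage.Theses.CharDial.WalkHardFJLinOdd :=
  charDial_walkHardFJLinOdd_iff_groupCore.2 hC

/-- **CharDial item 32604 ⟺ (A ∧ B at every prime `p ≥ 5`).** -/
theorem charDial_walkHardFJLinOdd_iff_readSplit :
    Summit.QuantumAdvantage.QuantumAdvantage.Theses.CharDial.WalkHardFJLinOdd ↔
      (∀ (p : ℕ) [Fact p.Prime], 5 ≤ p →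
        ∀ K : ℕ, 1 ≤ K → ∃ θ : ℝ, θ < 1 ∧ ∃ n₀ : ℕ, ∀ n ≥ n₀, ∀ (c : ℕ) (D : JLinData p n),
      (∀ g, (D.J g).card ≤ Nat.log 2 n) → D.sparseBits (n / K + 1) = ∅ → (winCount c D.strat : ℝ) ≤ θ * (2 : ℝ) ^ n) ∧
      (∀ (p : ℕ) [Fact p.Prime], 5 ≤ p →
        ∃ K : ℕ, 1 ≤ K ∧ ∀ C' : ℕ, 1 ≤ C' → ∃ θ : ℝ, θ < 1 ∧ ∃ n₀ : ℕ, ∀ n ≥ n₀, ∀ (c : ℕ) (D : JLinData p n),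
      (∀ g, (D.J g).card ≤ Nat.log 2 n) → D.lightGroups (C' * Nat.log 2 n) = ∅ →
        D.sparseBits (n / K + 1) ≠ ∅ → (winCount c D.strat : ℝ) ≤ θ * (2 : ℝ) ^ n) :=
  ⟨fun h => ⟨fun p _ hp => ((pres_iff_readSplit p (by omega)).1 (h p hp)).1,
      fun p _ hp => ((pres_iff_readSplit p (by omega)).1 (h p hp)).2⟩,
    fun h p _ hp => (pres_iff_readSplit p (by omega)).2 ⟨h.1 p hp, h.2 p hp⟩⟩

/-- **CharDial item 32604 ⟸ A ∧ B** (`closes` shape). -/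
theorem charDial_walkHardFJLinOdd_of_readSplit
    (hA : ∀ (p : ℕ) [Fact p.Prime], 5 ≤ p →
        ∀ K : ℕ, 1 ≤ K → ∃ θ : ℝ, θ < 1 ∧ ∃ n₀ : ℕ, ∀ n ≥ n₀, ∀ (c : ℕ) (D : JLinData p n),
      (∀ g, (D.J g).card ≤ Nat.log 2 n) → D.sparseBits (n / K + 1) = ∅ → (winCount c D.strat : ℝ) ≤ θ * (2 : ℝ) ^ n)
    (hB : ∀ (p : ℕ) [Fact p.Prime], 5 ≤ p →
        ∃ K : ℕ, 1 ≤ K ∧ ∀ C' : ℕ, 1 ≤ C' → ∃ θ : ℝ, θ < 1 ∧ ∃ n₀ : ℕ, ∀ n ≥ n₀, ∀ (c : ℕ) (D : JLinData p n),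
      (∀ g, (D.J g).card ≤ Nat.log 2 n) → D.lightGroups (C' * Nat.log 2 n) = ∅ →
        D.sparseBits (n / K + 1) ≠ ∅ → (winCount c D.strat : ℝ) ≤ θ * (2 : ℝ) ^ n) :
    Summit.QuantumAdvantage.QuantumAdvantage.Theses.CharDial.WalkHardFJLinOdd :=
  charDial_walkHardFJLinOdd_iff_readSplit.2 ⟨hA, hB⟩

/-- CharDial's rank-2 crux `FrobHardOdd` (32598) from `FrobStructureLaw` (32603) and group-core hardness. -/
theorem charDial_frobHardOdd_of_groupCore (hL : Summit.QuantumAdvantage.QuantumAdvantage.Theses.CharDial.FrobStructureLaw)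
    (hC : ∀ (p : ℕ) [Fact p.Prime], 5 ≤ p →
      ∀ C' : ℕ, ∃ θ : ℝ, θ < 1 ∧ ∃ n₀ : ℕ, ∀ n ≥ n₀, ∀ (c : ℕ) (D : JLinData p n),
      (∀ g, (D.J g).card ≤ Nat.log 2 n) → D.lightGroups (C' * Nat.log 2 n) = ∅ → (winCount c D.strat : ℝ) ≤ θ * (2 : ℝ) ^ n) :
    Summit.QuantumAdvantage.QuantumAdvantage.Theses.CharDial.FrobHardOdd :=
  charDial_frobHardOdd_of_core hL (fun p _ hp => (core_iff_groupCore p (by omega)).2 (hC p hp))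

/-- **CharDial's leaf from `FrobStructureLaw` (32603), group-core hardness, `FrobLiftOdd` (32599), `DegLiftOdd` (32600).** -/
theorem charDial_closes_of_groupCore (hL : Summit.QuantumAdvantage.QuantumAdvantage.Theses.CharDial.FrobStructureLaw)
    (hC : ∀ (p : ℕ) [Fact p.Prime], 5 ≤ p →
      ∀ C' : ℕ, ∃ θ : ℝ, θ < 1 ∧ ∃ n₀ : ℕ, ∀ n ≥ n₀, ∀ (c : ℕ) (D : JLinData p n),
      (∀ g, (D.J g).card ≤ Nat.log 2 n) → D.lightGroups (C' * Nat.log 2 n) = ∅ → (winCount c D.strat : ℝ) ≤ θ * (2 : ℝ) ^ n)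
    (hLift : Summit.QuantumAdvantage.QuantumAdvantage.Theses.CharDial.FrobLiftOdd) (hD : Summit.QuantumAdvantage.QuantumAdvantage.Theses.CharDial.DegLiftOdd) :
    Summit.QuantumAdvantage.AdviceFreeQNC0.AdviceFreeQNC0Odd :=
  charDial_closes_of_core hL (fun p _ hp => (core_iff_groupCore p (by omega)).2 (hC p hp)) hLift hD

/-- **CharDial's leaf from 32603, the two read-density pieces, 32599 and 32600.** -/
theorem charDial_closes_of_readSplit (hL : Summit.QuantumAdvantage.QuantumAdvantage.Theses.CharDial.FrobStructureLaw)
    (hA : ∀ (p : ℕ) [Fact p.Prime], 5 ≤ p →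
        ∀ K : ℕ, 1 ≤ K → ∃ θ : ℝ, θ < 1 ∧ ∃ n₀ : ℕ, ∀ n ≥ n₀, ∀ (c : ℕ) (D : JLinData p n),
      (∀ g, (D.J g).card ≤ Nat.log 2 n) → D.sparseBits (n / K + 1) = ∅ → (winCount c D.strat : ℝ) ≤ θ * (2 : ℝ) ^ n)
    (hB : ∀ (p : ℕ) [Fact p.Prime], 5 ≤ p →
        ∃ K : ℕ, 1 ≤ K ∧ ∀ C' : ℕ, 1 ≤ C' → ∃ θ : ℝ, θ < 1 ∧ ∃ n₀ : ℕ, ∀ n ≥ n₀, ∀ (c : ℕ) (D : JLinData p n),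
      (∀ g, (D.J g).card ≤ Nat.log 2 n) → D.lightGroups (C' * Nat.log 2 n) = ∅ →
        D.sparseBits (n / K + 1) ≠ ∅ → (winCount c D.strat : ℝ) ≤ θ * (2 : ℝ) ^ n)
    (hLift : Summit.QuantumAdvantage.QuantumAdvantage.Theses.CharDial.FrobLiftOdd) (hD : Summit.QuantumAdvantage.QuantumAdvantage.Theses.CharDial.DegLiftOdd) :
    Summit.QuantumAdvantage.AdviceFreeQNC0.AdviceFreeQNC0Odd :=
  charDial_closes_of_groupCore hL (fun p _ hp => groupCore_of_readSplit p (hA p hp) (hB p hp)) hLift hD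

end Summit.QuantumAdvantage.AdviceFreeQNC0.JLinPeel

end
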